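import Literature.AlgebraicGeometry.Modules.PullbackUnitComp
import Mathlib.CategoryTheory.Adjunction.Mates
import Mathlib.CategoryTheory.Adjunction.FullyFaithful
import HarnessLib

/-!
# Push-forward along an isomorphism of schemes: the equivalence, and the unit coherence for `(f ≫ ε)_* (f ≫ ε)^*`

Layer `Literature/AlgebraicGeometry/Modules`; pure category theory on Mathlib's `Scheme.Modules.pushforward`
/ `Scheme.Modules.pullback` / `pullbackPushforwardAdjunction` / `pushforwardComp` / `pullbackComp`
(everything PROVED, no named facts). For an ISOMORPHISM of schemes `ε : Y₀ ≅ Y₁`: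

* `pushforwardEquivOfIso ε : Y₀.Modules ≌ Y₁.Modules` (push-forward along `ε`, inverse along `ε⁻¹`),
  whence `ε_*` is an equivalence, the counit `ε^* ε_* ⟶ 𝟭` is an isomorphism (`isIso_counit`,
  `counitAppIso`), and `pullbackIsoOfIsoPushforward ε a : ε^* A ≅ B` from `a : A ≅ ε_* B`, whose
  adjoint is `a.hom` (`homEquiv_pullbackIsoOfIsoPushforward_hom`);
* the nested-typing wrappers `unitApp`, `pullbackCompInvApp`, `pushforwardCompHomApp/InvApp`
  (Mathlib's unit / `pullbackComp` / `pushforwardComp` components with objects written `f_* (f^* A)`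
  rather than `(f^* ⋙ f_*) A`, so that rewriting is type-correct at instances transparency) and the
  MATE identity `unitApp_comp` — `pushforwardComp` is the conjugate of `pullbackComp`
  (Mathlib `unit_conjugateEquiv` + `Scheme.Modules.conjugateEquiv_pullbackComp_inv`) — with its
  consequence `unit_comp_map_pullbackComp_inv_map` (the tree's `PullbackUnitComp.unit_comp_map_pullbackComp_inv` with an extra map `ν : g^*A ⟶ B`);
* **`pushforwardPullbackCompIso f ε a : (f ≫ ε)_* (f ≫ ε)^* A ≅ ε_* f_* f^* B`** and
  **`unit_comp_pushforwardPullbackCompIso_hom : η_{f≫ε}(A) ≫ (…).hom = a.hom ≫ ε_*(η_f(B))`**.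

Motivation (venture HSemireg, bridge (B1), residual gap (T), step W3(b)): Bloch's pairing
(`HodgeTheory/BlochSemiregularityMapReal.lean`) takes values in `i_* i^* Ωⁿ` (`formsOnSubscheme i n`)
through the unit `restrictForms i n : Ωⁿ ⟶ i_* i^* Ωⁿ`; with `f = i`, `ε` the model isomorphism and
`a = hodgeSheaf.comapIso` (`HodgeTheory/HodgeSheafComapIso.lean`) this file gives
`formsOnSubscheme (i ≫ ε) n ≅ ε_* (formsOnSubscheme i n)` compatibly with `restrictForms` — the
coefficient sheaf of the pairing's target transports along `ε`.

References: R. Hartshorne, *Algebraic Geometry* (1977), II §5 p. 110 (`f^*` is left adjoint to `f_*`;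
`(g ∘ f)_* = g_* ∘ f_*`); the statements are the standard mate calculus for these adjunctions
(reading; no printed statement is typed verbatim). [Hartshorne1977]
-/

noncomputable section

open CategoryTheory AlgebraicGeometry Opposite TopologicalSpace
open AlgebraicGeometry.Scheme.Modules

universe u

namespace Literature.AlgebraicGeometry.Modules

variable {Z Y₀ Y₁ : Scheme.{u}}


/-- The unit `η_f(A) : A ⟶ f_* f^* A` of `f^* ⊣ f_*` (Mathlib's `pullbackPushforwardAdjunction`), retyped
with NESTED objects (`f_* (f^* A)` instead of `(f^* ⋙ f_*) A`) so that compositions with it are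
type-correct at instances transparency (where `Functor.comp` does not unfold). [folklore] -/
def unitApp (f : Z ⟶ Y₀) (A : Y₀.Modules) :
    A ⟶ (pushforward f).obj ((Scheme.Modules.pullback f).obj A) :=
  (pullbackPushforwardAdjunction f).unit.app A

/-- Naturality of the unit. [cite: Hartshorne1977, II §5 p. 110 (f^* is left adjoint to f_*; reading: mate calculus along (g ∘ f)_* = g_* ∘ f_*)] -/
theorem unitApp_naturality (f : Z ⟶ Y₀) {A A' : Y₀.Modules} (φ : A ⟶ A') :
    unitApp f A ≫ (pushforward f).map ((Scheme.Modules.pullback f).map φ) = φ ≫ unitApp f A' :=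
  (pullbackPushforwardAdjunction f).unit_naturality φ

/-- `adj.homEquiv ν = η ≫ f_* ν` in the nested typing. [cite: Hartshorne1977, II §5 p. 110 (f^* is left adjoint to f_*; reading: mate calculus along (g ∘ f)_* = g_* ∘ f_*)] -/
theorem homEquiv_eq (f : Z ⟶ Y₀) (A : Y₀.Modules) (B : Z.Modules)
    (ν : (Scheme.Modules.pullback f).obj A ⟶ B) :
    (pullbackPushforwardAdjunction f).homEquiv A B ν = unitApp f A ≫ (pushforward f).map ν :=
  (pullbackPushforwardAdjunction f).homEquiv_unit A B ν

/-- `(f ≫ g)^* A ⟶ f^* g^* A` (Mathlib's `pullbackComp`), nested typing. [folklore] -/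
def pullbackCompInvApp (f : Z ⟶ Y₀) (g : Y₀ ⟶ Y₁) (A : Y₁.Modules) :
    (Scheme.Modules.pullback (f ≫ g)).obj A ⟶
      (Scheme.Modules.pullback f).obj ((Scheme.Modules.pullback g).obj A) :=
  (pullbackComp f g).inv.app A

/-- `g_* f_* X ⟶ (f ≫ g)_* X` (Mathlib's `pushforwardComp`), nested typing. [folklore] -/
def pushforwardCompHomApp (f : Z ⟶ Y₀) (g : Y₀ ⟶ Y₁) (X : Z.Modules) :
    (pushforward g).obj ((pushforward f).obj X) ⟶ (pushforward (f ≫ g)).obj X :=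
  (pushforwardComp f g).hom.app X

/-- `(f ≫ g)_* X ⟶ g_* f_* X` (Mathlib's `pushforwardComp`), nested typing. [folklore] -/
def pushforwardCompInvApp (f : Z ⟶ Y₀) (g : Y₀ ⟶ Y₁) (X : Z.Modules) :
    (pushforward (f ≫ g)).obj X ⟶ (pushforward g).obj ((pushforward f).obj X) :=
  (pushforwardComp f g).inv.app X

/-- Conjugating `(f ≫ g)_* φ` by `pushforwardComp` gives `g_* f_* φ`. [cite: Hartshorne1977, II §5 p. 110 (f^* is left adjoint to f_*; reading: mate calculus along (g ∘ f)_* = g_* ∘ f_*)] -/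
theorem pushforwardCompHomApp_naturality (f : Z ⟶ Y₀) (g : Y₀ ⟶ Y₁) {X Y : Z.Modules} (φ : X ⟶ Y) :
    pushforwardCompHomApp f g X ≫ (pushforward (f ≫ g)).map φ ≫ pushforwardCompInvApp f g Y =
      (pushforward g).map ((pushforward f).map φ) := by
  have nat := (pushforwardComp f g).hom.naturality φ
  have hid := (pushforwardComp f g).hom_inv_id_app Y
  change (pushforward g).map ((pushforward f).map φ) ≫ pushforwardCompHomApp f g Y =
    pushforwardCompHomApp f g X ≫ (pushforward (f ≫ g)).map φ at nat
  change pushforwardCompHomApp f g Y ≫ pushforwardCompInvApp f g Y = 𝟙 _ at hid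
  rw [← Category.assoc, ← nat, Category.assoc, hid, Category.comp_id]

/-- **`pushforwardComp` is the mate of `pullbackComp`, unit form** (the tree's
`Modules.unit_comp_map_pullbackComp_inv` of `PullbackUnitComp.lean`, restated in the nested typing):
`η_{f≫g}(A) ≫ (f ≫ g)_*((f ≫ g)^*A ⟶ f^*g^*A) = η_g(A) ≫ g_*(η_f(g^*A)) ≫ (g_* f_* ⟶ (f ≫ g)_*)`.
[cite: Hartshorne1977, II §5 p. 110 (f^* is left adjoint to f_*; reading: mate calculus along (g ∘ f)_* = g_* ∘ f_*)] -/
theorem unitApp_comp (f : Z ⟶ Y₀) (g : Y₀ ⟶ Y₁) (A : Y₁.Modules) :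
    unitApp (f ≫ g) A ≫ (pushforward (f ≫ g)).map (pullbackCompInvApp f g A) =
      unitApp g A ≫ (pushforward g).map (unitApp f ((Scheme.Modules.pullback g).obj A)) ≫
        pushforwardCompHomApp f g _ :=
  unit_comp_map_pullbackComp_inv f g A

/-- **The unit coherence**: for `ν : g^*A ⟶ B`,
`η_{f≫g}(A) ≫ (f ≫ g)_*(((f ≫ g)^*A ⟶ f^*g^*A) ≫ f^*ν) ≫ ((f ≫ g)_* ⟶ g_* f_*) = η_g(A) ≫ g_*ν ≫ g_*(η_f(B))`.
[cite: Hartshorne1977, II §5 p. 110 (f^* is left adjoint to f_*; reading: mate calculus along (g ∘ f)_* = g_* ∘ f_*)] -/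
theorem unit_comp_map_pullbackComp_inv_map (f : Z ⟶ Y₀) (g : Y₀ ⟶ Y₁) (A : Y₁.Modules) (B : Y₀.Modules)
    (ν : (Scheme.Modules.pullback g).obj A ⟶ B) :
    unitApp (f ≫ g) A ≫
      (pushforward (f ≫ g)).map (pullbackCompInvApp f g A ≫ (Scheme.Modules.pullback f).map ν) ≫
        pushforwardCompInvApp f g ((Scheme.Modules.pullback f).obj B) =
      unitApp g A ≫ (pushforward g).map ν ≫ (pushforward g).map (unitApp f B) := by
  rw [Functor.map_comp, ← Category.assoc, ← Category.assoc (unitApp (f ≫ g) A), unitApp_comp,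
    Category.assoc, Category.assoc, Category.assoc, pushforwardCompHomApp_naturality,
    ← (pushforward g).map_comp, unitApp_naturality, (pushforward g).map_comp]


/-- **Push-forward of `𝒪`-modules along an isomorphism of schemes is an equivalence of categories**
`Y₀.Modules ≌ Y₁.Modules` (inverse: push-forward along `ε⁻¹`; unit and counit from Mathlib's
`pushforwardId`, `pushforwardCongr`, `pushforwardComp`, adjointified by `Equivalence.mk`). [folklore] -/
def pushforwardEquivOfIso (ε : Y₀ ≅ Y₁) : Y₀.Modules ≌ Y₁.Modules :=
  CategoryTheory.Equivalence.mk (pushforward ε.hom) (pushforward ε.inv)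
    ((pushforwardId Y₀).symm ≪≫ (pushforwardCongr ε.hom_inv_id).symm ≪≫
      (pushforwardComp ε.hom ε.inv).symm)
    (pushforwardComp ε.inv ε.hom ≪≫ pushforwardCongr ε.inv_hom_id ≪≫ pushforwardId Y₁)

/-- `ε_*` is an equivalence for an isomorphism `ε`. [folklore] -/
instance isEquivalence_pushforward_hom (ε : Y₀ ≅ Y₁) : (pushforward ε.hom).IsEquivalence :=
  (pushforwardEquivOfIso ε).isEquivalence_functor

/-- The counit `ε^* ε_* ⟶ 𝟭` is an isomorphism for an isomorphism `ε` (`ε_*` is fully faithful).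
[folklore] -/
instance isIso_counit (ε : Y₀ ≅ Y₁) : IsIso (pullbackPushforwardAdjunction ε.hom).counit :=
  inferInstance

/-- Components of the counit are isomorphisms for an isomorphism `ε`. [folklore] -/
instance isIso_counit_app (ε : Y₀ ≅ Y₁) (B : Y₀.Modules) :
    IsIso ((pullbackPushforwardAdjunction ε.hom).counit.app B) :=
  NatIso.isIso_app_of_isIso _ B

/-- The counit component `ε^* ε_* B ≅ B` as an isomorphism, nested typing. [folklore] -/
def counitAppIso (ε : Y₀ ≅ Y₁) (B : Y₀.Modules) :
    (Scheme.Modules.pullback ε.hom).obj ((pushforward ε.hom).obj B) ≅ B :=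
  @asIso _ _ _ _ ((pullbackPushforwardAdjunction ε.hom).counit.app B) (isIso_counit_app ε B)

/-- **From `a : A ≅ ε_* B` to `ε^* A ≅ B`** (for an isomorphism `ε`): `ε^* a` followed by the (iso)
counit. [folklore] -/
def pullbackIsoOfIsoPushforward (ε : Y₀ ≅ Y₁) {A : Y₁.Modules} {B : Y₀.Modules}
    (a : A ≅ (pushforward ε.hom).obj B) : (Scheme.Modules.pullback ε.hom).obj A ≅ B :=
  (Scheme.Modules.pullback ε.hom).mapIso a ≪≫ counitAppIso ε B

/-- The adjoint of `pullbackIsoOfIsoPushforward ε a` is `a.hom`. [cite: Hartshorne1977, II §5 p. 110 (f^* is left adjoint to f_*; reading: mate calculus along (g ∘ f)_* = g_* ∘ f_*)] -/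
theorem homEquiv_pullbackIsoOfIsoPushforward_hom (ε : Y₀ ≅ Y₁) {A : Y₁.Modules} {B : Y₀.Modules}
    (a : A ≅ (pushforward ε.hom).obj B) :
    (pullbackPushforwardAdjunction ε.hom).homEquiv A B (pullbackIsoOfIsoPushforward ε a).hom = a.hom := by
  change (pullbackPushforwardAdjunction ε.hom).homEquiv A B
    ((Scheme.Modules.pullback ε.hom).map a.hom ≫ (pullbackPushforwardAdjunction ε.hom).counit.app B) = a.hom
  rw [← Adjunction.homEquiv_counit, Equiv.apply_symm_apply]

/-- **`(f ≫ ε)_* (f ≫ ε)^* A ≅ ε_* f_* f^* B`** for an isomorphism of schemes `ε : Y₀ ≅ Y₁`, a morphism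
`f : Z ⟶ Y₀` and an isomorphism `a : A ≅ ε_* B` of modules: `(f ≫ ε)_*` of
`(f ≫ ε)^*A ≅ f^*ε^*A ≅ f^*B` (`pullbackComp`, `pullbackIsoOfIsoPushforward`), then `(f ≫ ε)_* ≅ ε_* f_*`
(`pushforwardComp`). [folklore] -/
def pushforwardPullbackCompIso (f : Z ⟶ Y₀) (ε : Y₀ ≅ Y₁) {A : Y₁.Modules} {B : Y₀.Modules}
    (a : A ≅ (pushforward ε.hom).obj B) :
    (pushforward (f ≫ ε.hom)).obj ((Scheme.Modules.pullback (f ≫ ε.hom)).obj A) ≅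
      (pushforward ε.hom).obj ((pushforward f).obj ((Scheme.Modules.pullback f).obj B)) :=
  (pushforward (f ≫ ε.hom)).mapIso
      ((pullbackComp f ε.hom).symm.app A ≪≫
        (Scheme.Modules.pullback f).mapIso (pullbackIsoOfIsoPushforward ε a)) ≪≫
    (pushforwardComp f ε.hom).symm.app _

/-- **Compatibility of `pushforwardPullbackCompIso` with the units**:
`η_{f≫ε}(A) ≫ (pushforwardPullbackCompIso f ε a).hom = a.hom ≫ ε_*(η_f(B))` — the unit of
`(f ≫ ε)^* ⊣ (f ≫ ε)_*` on `A` corresponds, through `a` and the isomorphism, to `ε_*` of the unit of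
`f^* ⊣ f_*` on `B` (mate calculus: `unit_comp_map_pullbackComp_inv_map` + the adjoint of
`pullbackIsoOfIsoPushforward` being `a.hom`). [cite: Hartshorne1977, II §5 p. 110 (f^* is left adjoint to f_*; reading: mate calculus along (g ∘ f)_* = g_* ∘ f_*)] -/
theorem unit_comp_pushforwardPullbackCompIso_hom (f : Z ⟶ Y₀) (ε : Y₀ ≅ Y₁) {A : Y₁.Modules}
    {B : Y₀.Modules} (a : A ≅ (pushforward ε.hom).obj B) :
    (pullbackPushforwardAdjunction (f ≫ ε.hom)).unit.app A ≫ (pushforwardPullbackCompIso f ε a).hom =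
      a.hom ≫ (pushforward ε.hom).map ((pullbackPushforwardAdjunction f).unit.app B) := by
  change unitApp (f ≫ ε.hom) A ≫
    (pushforward (f ≫ ε.hom)).map (pullbackCompInvApp f ε.hom A ≫
      (Scheme.Modules.pullback f).map (pullbackIsoOfIsoPushforward ε a).hom) ≫
        pushforwardCompInvApp f ε.hom ((Scheme.Modules.pullback f).obj B) =
    a.hom ≫ (pushforward ε.hom).map (unitApp f B)
  rw [unit_comp_map_pullbackComp_inv_map, ← reassoc_of% (homEquiv_eq ε.hom A B _),
    homEquiv_pullbackIsoOfIsoPushforward_hom]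


end Literature.AlgebraicGeometry.Modules

end
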